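/-
Copyright (c) 2026 the pub-hodgecm-mathlib formalisation cell (harness21).  Prover seat hodgecm-mathlib-K2E3-p19 (g0), 2026-09-03.  Track B «K2-LIT», engine E3, WILD CHAIN
(K2E3-plan (g1) DEALS BATCH #2; line lead K2E3-p17 FILE ↦ SEAT MAP 22:22:15Z «p19 = FILE 1-W + FILE 2-W»; FILE 1-W landed by the lattice-leaf lead K2E3-p21 as
★ `K2E3WildHorocyclesAtDatum`), the wild twin of E1 row 56-B3(55-B) FILE 2.
-/
import Summits.HodgeConjecture.HodgeConjecture.Theorems.K2E3WildHorocyclesAtDatum   -- ★ FILE 1-W (K2E3-p21, landed 22:24Z): `exists_horocycleIndex_vertices∕edges_of_ramified`; brings ★ FILE 1-RAM (§1 torus letters `_of_involution`), ★ B-1, ★ B1, ★ p855217 (H5)–(H8)-ram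
import HarnessLib

/-!
# K2·E3 — WILD CHAIN file `K2E3HorocycleDataAtDatumWild`: THE WILD TWIN of ★ 55-B-2 ∕ FILE 2-RAM «HOROCYCLE DATA AT THE DATUM» — the assembled vertex ∕ edge block-permutation
# letters of ★ 5b `sum_finrank_block_eigen_eq_of_tree` on the `U(Φ₃)(L⁺_v)` tree at a place RAMIFIED in `L`, ANY residue characteristic (dyadic = WILD included) — Bruhat–Tits 1972 §10; Serre, *Trees* II.1.1

Cell `pub/hodgecm-mathlib` (D-0151), crux H413 = `stmt-HodgeConjecture-24833`; lane `--kind proof --supports stmt-HodgeConjecture-24833 --as helper` (THEOREMS ONLY: no definition ∕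
instance ∕ notation ∕ named fact ∕ `sorry`; count-neutral: closes no node).  Namespace `Summit.HodgeConjecture.HodgeConjecture.Cruxes.H413.K2E3HorocycleDataAtDatumWild`.
Track B «K2-LIT» engine E3 (K2E3-plan (g1) DEALS BATCH #2, 2026-09-03T22:15:20Z: «K2E3-p19 (default `Theorems/K2E3HorocycleDataAtDatumWild.lean` + `…HorocyclesAtDatumWild`)»; WILD
ENGINE line lead K2E3-p17; lattice-leaf recipe K2E3-p21 22:21:30Z «`(hσϖ)(hres)(h2)(hnorm)` ↦ `(heven){d t}(hd)(h1d)(h2t)`, `…_of_neg` ↦ `…_of_ramified`»).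
Sibling of ★ FILE 2-RAM `F0P3cStCharTSHorocycleDataAtDatumRamified` (F0P3a-p06; E1 row 56-B3(55-B)): its two heads `exists_horocycleData_vertices_of_neg` ∕ `exists_horocycleData_edges_of_neg`
re-issued `_of_ramified` with the TAME letters `hσϖ hres h2 hnorm` replaced POSITIONALLY by Track A's ramified-datum letters `heven {d t} hd h1d h2t` (the conjuncts of ★
`IsRamifiedQuadraticDatum σ_w ϖ d t`, ★ `UnitaryThreeFourFrameDefs` — NO `σ_w ϖ = −ϖ`, NO `|2|_w = 1`, NO norm hypothesis, so DYADIC ramified places are covered); every other binder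
(`(w hw) {ϖ} (eA heA) {a} (ha) (A hA0 hA1) (hσ hvσ hϖ) (P₀ hP₀ τM hτA)`) and both conclusions VERBATIM (the edge certificates inside the statement print ★ B1's
`latticeGraph_adj_apartmentEnum_succ_of_involution`, proof-irrelevant); proofs = ★ FILE 2-RAM's over ★ FILE 1-W's (`K2E3WildHorocyclesAtDatum`, K2E3-p21) `_of_ramified` horocycle indices and ★ FILE 1-RAM's place-free
`_of_involution` torus letters.  CONSUMER: the WILD widening of row 61's `hsp` supplier (★ 5b `Representation.sum_finrank_block_eigen_eq_of_tree` at `Γ := Gqs L v`, `t := cmBorelTriple L 3 v`)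
in the WILD ENGINE's (A)-W ∕ TreeOrbitData-W files (K2E3-p17's map), towards `K2E3EPNormOneWild` (★73-W).
HONEST LABEL: count-neutral datum helper; nothing new mathematically (re-lettering of ★ heads); h413 OPEN; HC_CM is proved only modulo the 7 printed citations (2 remaining named inputs
hLiu418 = stmt-HodgeConjecture-24832, h413 = stmt-HodgeConjecture-24833) until rung 0 closes; nothing printed is asserted here.

## References
* [BruhatTits1972] F. Bruhat, J. Tits, *Groupes réductifs sur un corps local I*, Publ. Math. IHÉS 41 (1972), §10.
* [Serre1980Trees] J.-P. Serre, *Trees* (1980), Ch. II §1.1.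
* [Rogawski1990] J. D. Rogawski, *Automorphic Representations of Unitary Groups in Three Variables*, Ann. of Math. Stud. 123 (1990), §1.10 p. 9, §4.5 p. 45.
* [Casselman1995] W. Casselman, *Introduction to the theory of admissible representations of p-adic reductive groups* (1995), §6.3.
-/

set_option autoImplicit false
-- the mandated namespace has the single-problem summit's repeated segment (`HodgeConjecture.HodgeConjecture`)
set_option linter.dupNamespace false

noncomputable section

open NumberField IsDedekindDomain
open scoped Valued WithZero Matrix MatrixGroups
open Literature.NumberTheory.Rogawski1990 Literature.NumberTheory.Automorphic Literature.NumberTheory.Automorphic.UnitaryGroup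
open Literature.NumberTheory.Automorphic.UnitaryLatticeTree Literature.NumberTheory.Automorphic.HermitianLattice

namespace Summit.HodgeConjecture.HodgeConjecture.Cruxes.H413.K2E3HorocycleDataAtDatumWild

open Summit.HodgeConjecture.HodgeConjecture.Cruxes.H413.F0P3cStCharTSHorocyclesAtDatum
open Summit.HodgeConjecture.HodgeConjecture.Cruxes.H413.F0P3cStCharTSHorocyclesAtDatumRamified
open Summit.HodgeConjecture.HodgeConjecture.Cruxes.H413.K2E3WildHorocyclesAtDatum

/-! ## §1 THE ASSEMBLED BLOCK-PERMUTATION LETTERS OF ★ 5b `sum_finrank_block_eigen_eq_of_tree` AT THE DATUM at a ramified quadratic datum, tame or WILD (`R₀ = A(ℤ)`,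
`R₁ = {A j, A (j+1)}(ℤ)`, `rep = A ∘ idx`, `ht = idx ∕ 2`, `τM = τ`, `C = T ∩ Stab(A 0)`, `S₀ = {A 0, A 1}`, `S₁ = {e₀, e₁}`) -/

section Package

variable (L : Type) [Field L] [NumberField L] [IsCMField L] (v : HeightOneSpectrum (𝓞 ↥(maximalRealSubfield L)))
  (w : PlacesOver L v) (hw : IsCMField.complexConj L • w.1 = w.1) {ϖ : w.1.adicCompletion L}
  (eA : Gqs L v ≃ₜ* ↥(unitaryGroupOfForm (galAdicCompletionMap (L := L) (IsCMField.complexConj L) hw) ((StdForm.antidiagonal 3).over (w.1.adicCompletion L))))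
  (heA : ∀ g : Gqs L v,
    ((eA g : ↥(unitaryGroupOfForm (galAdicCompletionMap (L := L) (IsCMField.complexConj L) hw) ((StdForm.antidiagonal 3).over (w.1.adicCompletion L)))) :
        GL (Fin 3) (w.1.adicCompletion L)) =
      ((localNonsplitEquiv (IsCMField.complexConj L) (qsForm L) (IsCMField.complexConj_ne_one L) w hw g :
        ↥(unitaryGroupOfForm (galAdicCompletionMap (L := L) (IsCMField.complexConj L) hw) (placeForm (qsForm L) w.1))) : GL (Fin 3) (w.1.adicCompletion L)))
  {a : Gqs L v →* ((latticeGraph (galAdicCompletionMap (L := L) (IsCMField.complexConj L) hw) ϖ ((StdForm.antidiagonal 3).over (w.1.adicCompletion L))) ≃g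
    (latticeGraph (galAdicCompletionMap (L := L) (IsCMField.complexConj L) hw) ϖ ((StdForm.antidiagonal 3).over (w.1.adicCompletion L))))}
  (ha : ∀ g, a g = latticeGraphIso (galAdicCompletionMap (L := L) (IsCMField.complexConj L) hw) ϖ ((StdForm.antidiagonal 3).over (w.1.adicCompletion L)) (eA g))
  (A : ℤ → {M : Submodule 𝒪[(w.1.adicCompletion L)] (Fin 3 → (w.1.adicCompletion L)) //
    IsVertex (galAdicCompletionMap (L := L) (IsCMField.complexConj L) hw) ϖ ((StdForm.antidiagonal 3).over (w.1.adicCompletion L)) M})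
  (hA0 : ∀ c : ℤ, (A (2 * c)).1 = latt (Matrix.diagonal ![ϖ ^ c, (1 : w.1.adicCompletion L), ϖ ^ (-c)]))
  (hA1 : ∀ c : ℤ, (A (2 * c + 1)).1 = latt (Matrix.diagonal ![ϖ ^ (c + 1), (1 : w.1.adicCompletion L), ϖ ^ (-c)]))

include heA ha hA0 hA1 in
set_option maxHeartbeats 1600000 in  -- statement-level `whnf` on the datum vertex type over the CM carriers (= ★ B-2's ∕ FILE 2-RAM's budget, measured there)
/-- **(X1v)+(X2) THE VERTEX LETTERS OF ★ 5b AT THE DATUM, ASSEMBLED, at ANY ramified quadratic datum (tame or WILD)** (binder block `(hσϖ, hres, h2, hnorm) ↦ (heven, {d t}, hd, h1d, h2t)`; ★ FILE 1-W's `exists_horocycleIndex_vertices_of_ramified` + ★ FILE 1-RAM's place-free `apartmentEnum_eq_self_…_of_involution`; twin of ★ FILE 2-RAM `exists_horocycleData_vertices_of_neg`, conclusion VERBATIM).  Given the torus translation `τM` of §2 (`τM · A j = A (j+2)`) and `P₀ = Stab(A 0)` (48-datum's `hP₀` at the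
base edge `d₁ = {A 0, A 1}`): representative ∕ transporter ∕ height functions on VERTICES with `R₀ := A(ℤ)`, `rep₀ := A ∘ idx`, `ht₀ := idx ∕ 2` (floor): `tr₀ b ∈ N(L⁺_v)`,
`rep₀ b ∈ R₀`, `tr₀ b · rep₀ b = b`, `rep₀` is `N`-invariant and the identity on `R₀`, `τM` raises heights of representatives by one and reaches every representative, the compact
torus `C := T ∩ P₀` fixes `R₀` pointwise, and the height-zero representatives are EXACTLY `{A 0, A 1}` — the binders `rep₀ tr₀ htrN₀ hrepR₀ htr₀ hrep_act₀ hrep_id₀ ht₀ hsh₀ hsh₀'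
hCR₀ S₀ hS₀` of ★ `Representation.sum_finrank_block_eigen_eq_of_tree` at `Γ := Gqs L v`, `t := cmBorelTriple L 3 v` (with `hCM` = `inf_le_left`, `hCτ` = ★
`mul_comm_of_mem_cmBorelTriple_M`, `hC` = ★ `isCompact_cmBorelTriple_M_inf`, `hN` = ★ `isLimitOfCompactOpen_cmBorelTriple_N`).
[cite: BruhatTits1972, §10] [cite: Serre1980Trees, II.1.1] [cite: Rogawski1990, §1.10 p. 9; §4.5 p. 45] [cite: Casselman1995, §6.3] -/
theorem exists_horocycleData_vertices_of_ramified
    (hσ : ∀ x, (galAdicCompletionMap (L := L) (IsCMField.complexConj L) hw) ((galAdicCompletionMap (L := L) (IsCMField.complexConj L) hw) x) = x)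
    (hvσ : ∀ x, Valued.v ((galAdicCompletionMap (L := L) (IsCMField.complexConj L) hw) x) = Valued.v x) (hϖ : Valued.v ϖ = WithZero.exp (-1 : ℤ))
    (heven : ∀ x : (w.1.adicCompletion L), (galAdicCompletionMap (L := L) (IsCMField.complexConj L) hw) x = x → x ≠ 0 → ∃ n : ℤ, Valued.v x = WithZero.exp (2 * n))
    {d t : ℕ} (hd : Valued.v (ϖ - (galAdicCompletionMap (L := L) (IsCMField.complexConj L) hw) ϖ) = Valued.v ϖ ^ d) (h1d : 1 ≤ d)
    (h2t : Valued.v (2 : (w.1.adicCompletion L)) = Valued.v ϖ ^ t)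
    (P₀ : Subgroup (Gqs L v)) (hP₀ : ∀ g, g ∈ P₀ ↔ a g (A 0) = A 0)
    (τM : Gqs L v) (hτA : ∀ j : ℤ, a τM (A j) = A (j + 2)) :
    ∃ (rep₀ : {M : Submodule 𝒪[(w.1.adicCompletion L)] (Fin 3 → (w.1.adicCompletion L)) //
          IsVertex (galAdicCompletionMap (L := L) (IsCMField.complexConj L) hw) ϖ ((StdForm.antidiagonal 3).over (w.1.adicCompletion L)) M} →
        {M : Submodule 𝒪[(w.1.adicCompletion L)] (Fin 3 → (w.1.adicCompletion L)) //
          IsVertex (galAdicCompletionMap (L := L) (IsCMField.complexConj L) hw) ϖ ((StdForm.antidiagonal 3).over (w.1.adicCompletion L)) M})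
      (tr₀ : {M : Submodule 𝒪[(w.1.adicCompletion L)] (Fin 3 → (w.1.adicCompletion L)) //
          IsVertex (galAdicCompletionMap (L := L) (IsCMField.complexConj L) hw) ϖ ((StdForm.antidiagonal 3).over (w.1.adicCompletion L)) M} → Gqs L v)
      (ht₀ : {M : Submodule 𝒪[(w.1.adicCompletion L)] (Fin 3 → (w.1.adicCompletion L)) //
          IsVertex (galAdicCompletionMap (L := L) (IsCMField.complexConj L) hw) ϖ ((StdForm.antidiagonal 3).over (w.1.adicCompletion L)) M} → ℤ),
      (∀ b, tr₀ b ∈ (cmBorelTriple L 3 v : ParabolicTriple (Gqs L v)).N) ∧ (∀ b, rep₀ b ∈ Set.range A) ∧ (∀ b, a (tr₀ b) (rep₀ b) = b) ∧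
      (∀ n : Gqs L v, n ∈ (cmBorelTriple L 3 v : ParabolicTriple (Gqs L v)).N → ∀ b, rep₀ (a n b) = rep₀ b) ∧ (∀ r ∈ Set.range A, rep₀ r = r) ∧
      (∀ r ∈ Set.range A, ht₀ (rep₀ (a τM r)) = ht₀ r + 1) ∧ (∀ r' ∈ Set.range A, ∃ r ∈ Set.range A, rep₀ (a τM r) = r') ∧
      (∀ c : Gqs L v, c ∈ (cmBorelTriple L 3 v : ParabolicTriple (Gqs L v)).M ⊓ P₀ → ∀ r ∈ Set.range A, a c r = r) ∧
      (∀ r, (r ∈ Set.range A ∧ ht₀ r = 0) ↔ (r = A 0 ∨ r = A 1)) := by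
  obtain ⟨idx, tr, htrN, htr, hidxN, hidxA⟩ := exists_horocycleIndex_vertices_of_ramified L v w hw eA heA ha A hA0 hA1 hσ hvσ hϖ heven hd h1d h2t
  refine ⟨fun b => A (idx b), tr, fun b => idx b / 2, htrN, fun b => ⟨idx b, rfl⟩, htr, fun n hn b => by simp only [hidxN n hn b], ?_, ?_, ?_, ?_, ?_⟩
  · rintro r ⟨j, rfl⟩; simp only [hidxA]
  · rintro r ⟨j, rfl⟩; simp only [hτA, hidxA]; omega
  · rintro r' ⟨j, rfl⟩; exact ⟨A (j - 2), ⟨j - 2, rfl⟩, by simp only [hτA, hidxA, sub_add_cancel]⟩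
  · rintro c hc r ⟨j, rfl⟩
    exact apartmentEnum_eq_self_of_mem_cmBorelTriple_M_of_apply_zero_of_involution L v w hw eA heA ha A hA0 hA1 hσ hvσ hϖ hc.1 ((hP₀ c).1 hc.2) j
  · intro r
    constructor
    · rintro ⟨⟨j, rfl⟩, h⟩
      simp only [hidxA] at h
      have hj : j = 0 ∨ j = 1 := by omega
      rcases hj with rfl | rfl
      · exact Or.inl rfl
      · exact Or.inr rfl
    · rintro (rfl | rfl)
      · exact ⟨⟨0, rfl⟩, by simp only [hidxA]; norm_num⟩
      · exact ⟨⟨1, rfl⟩, by simp only [hidxA]; norm_num⟩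

include heA ha hA0 hA1 in
set_option maxHeartbeats 1600000 in  -- statement-level `whnf` on the datum edge type (= ★ B-2's ∕ FILE 2-RAM's budget)
/-- **(X1e)+(X2) THE EDGE LETTERS OF ★ 5b AT THE DATUM, ASSEMBLED, at ANY ramified quadratic datum (tame or WILD)** (binder block `(hσϖ, hres, h2, hnorm) ↦ (heven, {d t}, hd, h1d, h2t)`; ★ FILE 1-W's `exists_horocycleIndex_edges_of_ramified` + ★ FILE 1-RAM's place-free `mapEdgeSet_…_of_involution`; twin of ★ FILE 2-RAM `exists_horocycleData_edges_of_neg`; edge certificates ★ B1 `latticeGraph_adj_apartmentEnum_succ_of_involution`, proof-irrelevant; twin of ★ `exists_horocycleData_edges`, conclusion VERBATIM) (`act₁ g := (a g).mapEdgeSet`, `R₁ := {A j, A (j+1)}(ℤ)`, `rep₁ := E ∘ idx₁`, `ht₁ := idx₁ ∕ 2`): the binders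
`rep₁ tr₁ htrN₁ hrepR₁ htr₁ hrep_act₁ hrep_id₁ ht₁ hsh₁ hsh₁' hCR₁ S₁ hS₁` of ★ `Representation.sum_finrank_block_eigen_eq_of_tree`, with `S₁ = { {A 0, A 1}, {A 1, A 2} }`.
[cite: BruhatTits1972, §10] [cite: Serre1980Trees, II.1.1] [cite: Rogawski1990, §1.10 p. 9; §4.5 p. 45] [cite: Casselman1995, §6.3] -/
theorem exists_horocycleData_edges_of_ramified
    (hσ : ∀ x, (galAdicCompletionMap (L := L) (IsCMField.complexConj L) hw) ((galAdicCompletionMap (L := L) (IsCMField.complexConj L) hw) x) = x)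
    (hvσ : ∀ x, Valued.v ((galAdicCompletionMap (L := L) (IsCMField.complexConj L) hw) x) = Valued.v x) (hϖ : Valued.v ϖ = WithZero.exp (-1 : ℤ))
    (heven : ∀ x : (w.1.adicCompletion L), (galAdicCompletionMap (L := L) (IsCMField.complexConj L) hw) x = x → x ≠ 0 → ∃ n : ℤ, Valued.v x = WithZero.exp (2 * n))
    {d t : ℕ} (hd : Valued.v (ϖ - (galAdicCompletionMap (L := L) (IsCMField.complexConj L) hw) ϖ) = Valued.v ϖ ^ d) (h1d : 1 ≤ d)
    (h2t : Valued.v (2 : (w.1.adicCompletion L)) = Valued.v ϖ ^ t)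
    (P₀ : Subgroup (Gqs L v)) (hP₀ : ∀ g, g ∈ P₀ ↔ a g (A 0) = A 0)
    (τM : Gqs L v) (hτA : ∀ j : ℤ, a τM (A j) = A (j + 2)) :
    ∃ (rep₁ : (latticeGraph (galAdicCompletionMap (L := L) (IsCMField.complexConj L) hw) ϖ ((StdForm.antidiagonal 3).over (w.1.adicCompletion L))).edgeSet → (latticeGraph (galAdicCompletionMap (L := L) (IsCMField.complexConj L) hw) ϖ ((StdForm.antidiagonal 3).over (w.1.adicCompletion L))).edgeSet) (tr₁ : (latticeGraph (galAdicCompletionMap (L := L) (IsCMField.complexConj L) hw) ϖ ((StdForm.antidiagonal 3).over (w.1.adicCompletion L))).edgeSet → Gqs L v) (ht₁ : (latticeGraph (galAdicCompletionMap (L := L) (IsCMField.complexConj L) hw) ϖ ((StdForm.antidiagonal 3).over (w.1.adicCompletion L))).edgeSet → ℤ),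
      (∀ d, tr₁ d ∈ (cmBorelTriple L 3 v : ParabolicTriple (Gqs L v)).N) ∧
      (∀ d, rep₁ d ∈ (Set.range fun j : ℤ => (⟨s(A j, A (j + 1)), (SimpleGraph.mem_edgeSet _).2 (latticeGraph_adj_apartmentEnum_succ_of_involution hσ hvσ hϖ A hA0 hA1 j)⟩ : (latticeGraph (galAdicCompletionMap (L := L) (IsCMField.complexConj L) hw) ϖ ((StdForm.antidiagonal 3).over (w.1.adicCompletion L))).edgeSet))) ∧
      (∀ d, (a (tr₁ d)).mapEdgeSet (rep₁ d) = d) ∧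
      (∀ n : Gqs L v, n ∈ (cmBorelTriple L 3 v : ParabolicTriple (Gqs L v)).N → ∀ d, rep₁ ((a n).mapEdgeSet d) = rep₁ d) ∧
      (∀ r ∈ (Set.range fun j : ℤ => (⟨s(A j, A (j + 1)), (SimpleGraph.mem_edgeSet _).2 (latticeGraph_adj_apartmentEnum_succ_of_involution hσ hvσ hϖ A hA0 hA1 j)⟩ : (latticeGraph (galAdicCompletionMap (L := L) (IsCMField.complexConj L) hw) ϖ ((StdForm.antidiagonal 3).over (w.1.adicCompletion L))).edgeSet)), rep₁ r = r) ∧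
      (∀ r ∈ (Set.range fun j : ℤ => (⟨s(A j, A (j + 1)), (SimpleGraph.mem_edgeSet _).2 (latticeGraph_adj_apartmentEnum_succ_of_involution hσ hvσ hϖ A hA0 hA1 j)⟩ : (latticeGraph (galAdicCompletionMap (L := L) (IsCMField.complexConj L) hw) ϖ ((StdForm.antidiagonal 3).over (w.1.adicCompletion L))).edgeSet)), ht₁ (rep₁ ((a τM).mapEdgeSet r)) = ht₁ r + 1) ∧
      (∀ r' ∈ (Set.range fun j : ℤ => (⟨s(A j, A (j + 1)), (SimpleGraph.mem_edgeSet _).2 (latticeGraph_adj_apartmentEnum_succ_of_involution hσ hvσ hϖ A hA0 hA1 j)⟩ : (latticeGraph (galAdicCompletionMap (L := L) (IsCMField.complexConj L) hw) ϖ ((StdForm.antidiagonal 3).over (w.1.adicCompletion L))).edgeSet)), ∃ r ∈ (Set.range fun j : ℤ => (⟨s(A j, A (j + 1)), (SimpleGraph.mem_edgeSet _).2 (latticeGraph_adj_apartmentEnum_succ_of_involution hσ hvσ hϖ A hA0 hA1 j)⟩ : (latticeGraph (galAdicCompletionMap (L := L) (IsCMField.complexConj L) hw) ϖ ((StdForm.antidiagonal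 3).over (w.1.adicCompletion L))).edgeSet)), rep₁ ((a τM).mapEdgeSet r) = r') ∧
      (∀ c : Gqs L v, c ∈ (cmBorelTriple L 3 v : ParabolicTriple (Gqs L v)).M ⊓ P₀ → ∀ r ∈ (Set.range fun j : ℤ => (⟨s(A j, A (j + 1)), (SimpleGraph.mem_edgeSet _).2 (latticeGraph_adj_apartmentEnum_succ_of_involution hσ hvσ hϖ A hA0 hA1 j)⟩ : (latticeGraph (galAdicCompletionMap (L := L) (IsCMField.complexConj L) hw) ϖ ((StdForm.antidiagonal 3).over (w.1.adicCompletion L))).edgeSet)), (a c).mapEdgeSet r = r) ∧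
      (∀ r, (r ∈ (Set.range fun j : ℤ => (⟨s(A j, A (j + 1)), (SimpleGraph.mem_edgeSet _).2 (latticeGraph_adj_apartmentEnum_succ_of_involution hσ hvσ hϖ A hA0 hA1 j)⟩ : (latticeGraph (galAdicCompletionMap (L := L) (IsCMField.complexConj L) hw) ϖ ((StdForm.antidiagonal 3).over (w.1.adicCompletion L))).edgeSet)) ∧ ht₁ r = 0) ↔ (r = (⟨s(A 0, A (0 + 1)), (SimpleGraph.mem_edgeSet _).2 (latticeGraph_adj_apartmentEnum_succ_of_involution hσ hvσ hϖ A hA0 hA1 0)⟩ : (latticeGraph (galAdicCompletionMap (L := L) (IsCMField.complexConj L) hw) ϖ ((StdForm.antidiagonal 3).over (w.1.adicCompletion L))).edgeSet) ∨ r = (⟨s(A 1, A (1 + 1)), (SimpleGraph.mem_edgeSet _).2 (latticeGraph_adj_apartmentEnum_succ_of_involution hσ hvσ hϖ A hA0 hA1 1)⟩ : (latticeGraph (galAdicCompletionMap (L := L) (IsCMField.complexConj L) hw) ϖ ((StdForm.antidiagonal 3).over (w.1.adicCompletion L))).edgeSet))) := by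
  obtain ⟨idx₁, tr₁, htrN₁, htr₁, hidxN₁, hidxA₁⟩ := exists_horocycleIndex_edges_of_ramified L v w hw eA heA ha A hA0 hA1 hσ hvσ hϖ heven hd h1d h2t
  -- the torus translation on apartment edges
  have hτE : ∀ j : ℤ, (a τM).mapEdgeSet (⟨s(A j, A (j + 1)), (SimpleGraph.mem_edgeSet _).2 (latticeGraph_adj_apartmentEnum_succ_of_involution hσ hvσ hϖ A hA0 hA1 j)⟩ : (latticeGraph (galAdicCompletionMap (L := L) (IsCMField.complexConj L) hw) ϖ ((StdForm.antidiagonal 3).over (w.1.adicCompletion L))).edgeSet) = (⟨s(A (j + 2), A ((j + 2) + 1)), (SimpleGraph.mem_edgeSet _).2 (latticeGraph_adj_apartmentEnum_succ_of_involution hσ hvσ hϖ A hA0 hA1 (j + 2))⟩ : (latticeGraph (galAdicCompletionMap (L := L) (IsCMField.complexConj L) hw) ϖ ((StdForm.antidiagonal 3).over (w.1.adicCompletion L))).edgeSet) := fun j => by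
    apply Subtype.ext
    change Sym2.map (a τM) s(A j, A (j + 1)) = s(A (j + 2), A (j + 2 + 1))
    rw [Sym2.map_mk, hτA, hτA, show j + 1 + 2 = j + 2 + 1 by ring]
  refine ⟨fun d => (⟨s(A (idx₁ d), A ((idx₁ d) + 1)), (SimpleGraph.mem_edgeSet _).2 (latticeGraph_adj_apartmentEnum_succ_of_involution hσ hvσ hϖ A hA0 hA1 (idx₁ d))⟩ : (latticeGraph (galAdicCompletionMap (L := L) (IsCMField.complexConj L) hw) ϖ ((StdForm.antidiagonal 3).over (w.1.adicCompletion L))).edgeSet), tr₁, fun d => idx₁ d / 2, htrN₁, fun d => ⟨idx₁ d, rfl⟩, htr₁, fun n hn d => by simp only [hidxN₁ n hn d], ?_, ?_, ?_, ?_, ?_⟩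
  · rintro r ⟨j, rfl⟩
    simp only [hidxA₁]
  · rintro r ⟨j, rfl⟩
    simp only [hτE, hidxA₁]
    omega
  · rintro r' ⟨j, rfl⟩
    refine ⟨(⟨s(A (j - 2), A ((j - 2) + 1)), (SimpleGraph.mem_edgeSet _).2 (latticeGraph_adj_apartmentEnum_succ_of_involution hσ hvσ hϖ A hA0 hA1 (j - 2))⟩ : (latticeGraph (galAdicCompletionMap (L := L) (IsCMField.complexConj L) hw) ϖ ((StdForm.antidiagonal 3).over (w.1.adicCompletion L))).edgeSet), ⟨j - 2, rfl⟩, ?_⟩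
    simp only [hτE, hidxA₁, sub_add_cancel]
  · rintro c hc r ⟨j, rfl⟩
    exact mapEdgeSet_apartmentEnum_eq_self_of_mem_cmBorelTriple_M_of_apply_zero_of_involution L v w hw eA heA ha A hA0 hA1 hσ hvσ hϖ hc.1 ((hP₀ c).1 hc.2) j
  · intro r
    constructor
    · rintro ⟨⟨j, rfl⟩, h⟩
      simp only [hidxA₁] at h
      have hj : j = 0 ∨ j = 1 := by omega
      rcases hj with rfl | rfl
      · exact Or.inl rfl
      · exact Or.inr rfl
    · rintro (rfl | rfl)
      · exact ⟨⟨0, rfl⟩, by simp only [hidxA₁]; rfl⟩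
      · exact ⟨⟨1, rfl⟩, by simp only [hidxA₁]; rfl⟩

end Package

end Summit.HodgeConjecture.HodgeConjecture.Cruxes.H413.K2E3HorocycleDataAtDatumWild

end
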